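import Summits.Ventures.LatticeQCDFlow.Scaling.EntropicTransportSteps

/-!
# LatticeQCDFlow / Scaling — ENTROPIC TRANSPORT LAWS: a Lipschitz (co-Lipschitz) exact flow between couplings can lower (raise) the entropy deficit by at most `#E·(log(A/a) + κ·log Lip)`

HONEST FRAMING: exact (Metropolis-corrected) sampling algorithms for lattice gauge theory; figures of merit are
autocorrelation/cost numbers at stated couplings and volumes; no continuum-physics claim.

Venture `LatticeQCDFlow` (cell pub-lqcd), topic `Scaling`, FANOUT row 29 (theory-2) — OUR WORK (THEORY-2.md §3.3
v2.8, "(C2a-H) / (C2a-C′) / (C2a-C°) entropic transport laws").  Write `π = Haar^{⊗E}`, `μ_β = μ_{Λ,β}` (Wilson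
measure of a continuous `ρ` with `Re tr ρ ≤ N`, `β ≥ 0`) and `D_β = D(μ_β ‖ π)` (the entropy deficit; `D_0 = 0`).
The tree's transport laws between couplings (`Scaling/ExactTransportBetweenSteps.lean`, `ExactTransportBetween.lean`)
are ENERGETIC: STEP 1′ at a point of near-maximal action gives `Lip(T) ≥ e^{c(β-β₀)-C}` for COOLING flows
(`β ≥ β₀`).  This file INTEGRATES the same pointwise inequality against `μ_{β₀}` and reads it through the Gibbs
identity `D_β = -β⟨S⟩_β - log Z_β` (`gibbsIdentity`): the result is a pair of ENTROPIC inequalities, valid for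
EVERY pair of couplings `β₀, β ≥ 0` in either order and every volume,

* `klDiv_sub_klDiv_le_of_lipschitz` — for an exact `K`-Lipschitz transport `T_* μ_{β₀} = μ_β` (sup metric on
  `G^E`, two-sided ball volumes `a·r^κ ≤ Haar(B̄(g,r)) ≤ A·r^κ`):  `D_{β₀} - D_β ≤ #E·(log(A/a) + κ·log K)`;
* `klDiv_sub_klDiv_le_of_antilipschitz` — for an exact `K'`-co-Lipschitz transport (`AntilipschitzWith K' T`;
  measurability follows from exactness):  `D_β - D_{β₀} ≤ #E·(log(A/a) + κ·log K')`
  (from the new pointwise STEP 2′ `neg_log_partitionFunction_sub_le_between`: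
  `log Z_{β₀} - log Z_β + β₀·S(x) - β·S(Tx) ≤ #E·(log(A/a) + κ·log K')` at every `x`);

i.e. the metric-measure form of `h(TX) ≤ h(X) + dim·log Lip(T)` for the `κ·#E`-dimensional configuration space,
with NO smoothness or injectivity assumed.  Fed with the tree's two-sided ENTROPY-GROWTH LAW
(`Scaling/LatticeEntropyGrowthSharp.lean`: `κ((d-1)L^d(1/2-1/L) - 1/2)·log β - C·L^d ≤ D_β ≤ κ((d-1)L^d+1)/2·log β
+ C·L^d`, `β ≥ 1`, `L ≥ 2`; unconditional for `U(1)`, `U(N)`, `SU(N)`), they give three VOLUME-UNIFORM power laws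
(items, §0; `#E = d·L^d`, so the `L^d` cancel):

* `HeatingExpansionBetween` (C2a-H, the HEATING direction `1 ≤ β ≤ β₀`, left open in v2.7): an exact Lipschitz flow
  from the colder ensemble must EXPAND,
  `log Lip(T) ≥ [((d-1)(1/2-1/L) - 1/(2L^d))·log β₀ - ((d-1)/2 + 1/(2L^d))·log β]/d - C/κ`,
  i.e. `Lip(T) ≳ (β₀/β)^{(d-1)/(2d)}` up to the `O(1/L)` slack of the entropy-growth law (`d = 4`: exponent `3/8`);
* `CoolingContractionBetween` (C2a-C′, `1 ≤ β₀ ≤ β`): an exact co-Lipschitz flow to the colder ensemble must CONTRACT,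
  `log coLip(T) ≥ [((d-1)(1/2-1/L) - 1/(2L^d))·log β - ((d-1)/2 + 1/(2L^d))·log β₀]/d - C/κ`;
* `ExactTransportContractionSharp` (C2a-C°, from the PRIOR, `D_0 = 0`): `log coLip(T) ≥ ((d-1)(1/2-1/L) -
  1/(2L^d))/d·log β - C/κ` for every `L ≥ 2`, `β ≥ 1` — the tree's contraction law `ExactTransportContraction`
  (`Scaling/ExactTransportOneSided.lean`, exponent `1/(16d)`, `L ≥ 4`) with the VOLUMETRIC exponent
  `(d-1)/(2d)·(1 - O(1/L))` (`23/128` at `d = 4`, `L ≥ 4`, versus `1/64`): `exactTransportContraction_of_sharp`.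

Proved for every compact metric group with two-sided ball volumes (§2) and discharged with NO hypothesis left for
`U(1)` (`κ = 1`), `U(N)` (`κ = N²`, Hilbert–Schmidt metric) and `SU(N)` (`κ = N² - 1`; `SU(3)`, `d = 4` included)
in `Scaling/EntropicTransportInstances.lean`.  The two entropic inequalities and STEP 2′ are
`Scaling/EntropicTransportSteps.lean`.  Reading (THEORY-2 §5.11, barrier `TransportExpansionLaw`, supplement "the transport square"): between two
couplings the EXPONENTIAL obstruction (`e^{c|β-β₀|}`) always sits on the side that must populate the rare
high-action configurations of the HOTTER measure from the colder one (Lipschitz side when cooling, co-Lipschitz side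
when heating — the latter is (C2a-E′) applied to `T⁻¹` and is not typed here), while the ENTROPIC side is a power
law `(β_cold/β_hot)^{(d-1)/(2d)}` per link, extensive only as a log-Jacobian `(n_tr/2)·log(β_cold/β_hot)`,
`n_tr = κ(d-1)L^d`; the volumetric exponent cannot be beaten by any map (it is the Jacobian average) and is attained
only by isotropic contraction.  Elementary given the tree; nothing here is cited as a fact.  References for the
reading: Cover–Thomas, *Elements of Information Theory* 2nd ed., Thm 8.6.4 (`h(AX) = h(X) + log|det A|`); Villani,
*Topics in Optimal Transportation* (2003) §6 (change of variables for push-forwards); Abbott et al. arXiv:2211.07541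
§IV–V (volume scaling of flow-based samplers for gauge theory); Bulgarelli–Cellini–Nada arXiv:2412.00200 (flows
between couplings, 4-d `SU(3)`).
-/

noncomputable section

namespace Summit.Ventures.LatticeQCDFlow.Theory2.Lattice

open MeasureTheory InformationTheory Metric Set Literature.MathematicalPhysics.QuantumFieldTheory

/-! ## §0. The items -/

section Defs

variable (d N : ℕ) (G : Type) [Group G] [MetricSpace G] [IsTopologicalGroup G] [CompactSpace G]
  [MeasurableSpace G] [BorelSpace G] (ρ : G →* Matrix (Fin N) (Fin N) ℂ) (κ : ℝ)

/-- **(C2a-H) THE ENTROPIC EXPANSION LAW FOR HEATING FLOWS** (OURS, THEORY-2.md §3.3 v2.8): there is `C` such that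
for every `L ≥ 2`, every `1 ≤ β ≤ β₀` and every exact LIPSCHITZ transport `T` of `μ_{Λ,β₀}` onto `μ_{Λ,β}` (sup
metric on `G^E`),
`κ·[((d-1)L^d(1/2-1/L) - 1/2)·log β₀ - ((d-1)L^d+1)/2·log β] - C·L^d ≤ κ·d·L^d·log Lip(T)` —
`Lip(T) ≳ (β₀/β)^{(d-1)/(2d)}` uniformly in the volume (`κ` = the small-ball exponent of `G`, `= dim G` for a
faithful `ρ`).  Proved for two-sided ball volumes from the entropy-growth law (§2) and unconditionally for `U(1)`,
`U(N)`, `SU(N)` (§3). [folklore] -/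
@[conjecture]
def HeatingExpansionBetween : Prop :=
  ∃ C : ℝ, ∀ (L : ℕ) [NeZero L], 2 ≤ L → ∀ β₀ β : ℝ, 1 ≤ β → β ≤ β₀ →
    ∀ (T : GaugeConfig d L G → GaugeConfig d L G) (K : NNReal), LipschitzWith K T →
      (wilsonMeasure (d := d) (L := L) ρ β₀).map T = wilsonMeasure (d := d) (L := L) ρ β →
      κ * ((((d : ℝ) - 1) * (L : ℝ) ^ d * (1 / 2 - 1 / L) - 1 / 2) * Real.log β₀ -
            (((d : ℝ) - 1) * (L : ℝ) ^ d + 1) / 2 * Real.log β) - C * (L : ℝ) ^ d ≤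
        κ * ((d : ℝ) * (L : ℝ) ^ d) * Real.log (K : ℝ)

/-- **(C2a-C′) THE ENTROPIC CONTRACTION LAW FOR COOLING FLOWS** (OURS, THEORY-2.md §3.3 v2.8): there is `C` such
that for every `L ≥ 2`, every `1 ≤ β₀ ≤ β` and every exact CO-LIPSCHITZ transport `T` of `μ_{Λ,β₀}` onto `μ_{Λ,β}`
(`AntilipschitzWith K' T`, sup metric; measurability follows from exactness),
`κ·[((d-1)L^d(1/2-1/L) - 1/2)·log β - ((d-1)L^d+1)/2·log β₀] - C·L^d ≤ κ·d·L^d·log K'` —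
`coLip(T) ≳ (β/β₀)^{(d-1)/(2d)}` uniformly in the volume.  Proved as (C2a-H). [folklore] -/
@[conjecture]
def CoolingContractionBetween : Prop :=
  ∃ C : ℝ, ∀ (L : ℕ) [NeZero L], 2 ≤ L → ∀ β₀ β : ℝ, 1 ≤ β₀ → β₀ ≤ β →
    ∀ (T : GaugeConfig d L G → GaugeConfig d L G) (K' : NNReal), AntilipschitzWith K' T →
      (wilsonMeasure (d := d) (L := L) ρ β₀).map T = wilsonMeasure (d := d) (L := L) ρ β →
      κ * ((((d : ℝ) - 1) * (L : ℝ) ^ d * (1 / 2 - 1 / L) - 1 / 2) * Real.log β -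
            (((d : ℝ) - 1) * (L : ℝ) ^ d + 1) / 2 * Real.log β₀) - C * (L : ℝ) ^ d ≤
        κ * ((d : ℝ) * (L : ℝ) ^ d) * Real.log (K' : ℝ)

/-- **(C2a-C°) THE SHARP CONTRACTION LAW FROM THE PRIOR** (OURS, THEORY-2.md §3.3 v2.8): there is `C` such that for
every `L ≥ 2`, every `β ≥ 1` and every exact CO-LIPSCHITZ transport `T` of the product Haar prior onto `μ_{Λ,β}`,
`κ·((d-1)L^d(1/2-1/L) - 1/2)·log β - C·L^d ≤ κ·d·L^d·log K'` — `coLip(T) ≳ β^{(d-1)/(2d)}`, the volumetric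
exponent (the tree's `ExactTransportContraction` has `1/(16d)`).  Proved as (C2a-H). [folklore] -/
@[conjecture]
def ExactTransportContractionSharp : Prop :=
  ∃ C : ℝ, ∀ (L : ℕ) [NeZero L], 2 ≤ L → ∀ β : ℝ, 1 ≤ β →
    ∀ (T : GaugeConfig d L G → GaugeConfig d L G) (K' : NNReal), AntilipschitzWith K' T →
      (Measure.pi fun _ : Edge d L => haarProbability G).map T = wilsonMeasure (d := d) (L := L) ρ β →
      κ * (((d : ℝ) - 1) * (L : ℝ) ^ d * (1 / 2 - 1 / L) - 1 / 2) * Real.log β - C * (L : ℝ) ^ d ≤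
        κ * ((d : ℝ) * (L : ℝ) ^ d) * Real.log (K' : ℝ)

end Defs

/-! ## §2. The three laws from two-sided ball volumes and the entropy-growth law -/

section Laws

variable {N : ℕ} {G : Type} [Group G] [MetricSpace G] [IsTopologicalGroup G] [CompactSpace G]
  [SecondCountableTopology G] [MeasurableSpace G] [BorelSpace G]
  (ρ : G →* Matrix (Fin N) (Fin N) ℂ)

/-- **(C2a-H) PROVED from ball volumes + entropy growth** (OURS): two-sided ball volumes with exponent `κ ≥ 1`, a
continuous `ρ` with `-N ≤ Re tr ρ ≤ N`, `d ≥ 1`, and the two-sided entropy-growth bounds for `(ρ, κ)` (the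
conclusion of `EntropyGrowth d κ`) ⟹ `HeatingExpansionBetween d N G ρ κ` with `C = 2C_EG + d·log(A/a)`.
[folklore] -/
theorem heatingExpansionBetween_of_ballVolumes (d : ℕ) (hd : 1 ≤ d)
    (hρ : Continuous (ρ : G → Matrix (Fin N) (Fin N) ℂ))
    (htr : ∀ g, (ρ g).trace.re ≤ N) (htr' : ∀ g, -(N : ℝ) ≤ (ρ g).trace.re)
    {κ : ℕ} (hκ : 0 < κ) {a A : ℝ} (ha : 0 < a)
    (hlo : ∀ (g : G) (r : ℝ), 0 < r → r ≤ 1 → a * r ^ κ ≤ (haarProbability G (closedBall g r)).toReal)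
    (hup : ∀ (g : G) (r : ℝ), 0 < r → (haarProbability G (closedBall g r)).toReal ≤ A * r ^ κ)
    (hEG : ∃ C : ℝ, ∀ (L : ℕ) [NeZero L], 2 ≤ L → ∀ β : ℝ, 1 ≤ β →
      (κ : ℝ) * (((d : ℝ) - 1) * (L : ℝ) ^ d * (1 / 2 - 1 / L) - 1 / 2) * Real.log β - C * (L : ℝ) ^ d ≤
          (klDiv (wilsonMeasure (d := d) (L := L) ρ β) (Measure.pi fun _ : Edge d L => haarProbability G)).toReal ∧
        (klDiv (wilsonMeasure (d := d) (L := L) ρ β) (Measure.pi fun _ : Edge d L => haarProbability G)).toReal ≤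
          (κ : ℝ) * ((((d : ℝ) - 1) * (L : ℝ) ^ d + 1) / 2) * Real.log β + C * (L : ℝ) ^ d) :
    HeatingExpansionBetween d N G ρ κ := by
  have haA : a ≤ A := by
    have h1 := hlo 1 1 one_pos le_rfl
    have h2 := hup 1 1 one_pos
    rw [one_pow, mul_one] at h1 h2
    exact h1.trans h2
  have hA : 0 < A := ha.trans_le haA
  obtain ⟨C, hC⟩ := hEG
  refine ⟨2 * C + d * Real.log (A / a), fun L _ hL β₀ β hβ hββ₀ T K hT hmap => ?_⟩
  have hβ0 : 0 ≤ β := by linarith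
  have hβ₀0 : 0 ≤ β₀ := by linarith
  have hβ₀1 : 1 ≤ β₀ := hβ.trans hββ₀
  have hK0 := lipschitz_pos_of_map_eq_between ρ hd htr htr' hκ hA hup hβ0 hT hmap
  have hmain := klDiv_sub_klDiv_le_of_lipschitz ρ hρ htr ha hA hlo hup hβ₀0 hβ0 hK0 hT hmap
  have hlo' := (hC L hL β₀ hβ₀1).1
  have hup' := (hC L hL β hβ).2
  have hE : (Fintype.card (Edge d L) : ℝ) = d * (L : ℝ) ^ d := by
    have hEn : Fintype.card (Edge d L) = L ^ d * d := by simp [Fintype.card_prod, ZMod.card, Fintype.card_fin]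
    rw [hEn]; push_cast; ring
  rw [hE] at hmain
  linarith [hmain, hlo', hup']

/-- **(C2a-C′) PROVED from ball volumes + entropy growth** (OURS): two-sided ball volumes with exponent `κ ≥ 1`,
a continuous `ρ` with `Re tr ρ ≤ N`, `d ≥ 1`, and the two-sided entropy-growth bounds for `(ρ, κ)` ⟹
`CoolingContractionBetween d N G ρ κ` with `C = 2C_EG + d·log(A/a)`. [folklore] -/
theorem coolingContractionBetween_of_ballVolumes (d : ℕ) (hd : 1 ≤ d)
    (hρ : Continuous (ρ : G → Matrix (Fin N) (Fin N) ℂ)) (htr : ∀ g, (ρ g).trace.re ≤ N)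
    {κ : ℕ} (hκ : 0 < κ) {a A : ℝ} (ha : 0 < a)
    (hlo : ∀ (g : G) (r : ℝ), 0 < r → r ≤ 1 → a * r ^ κ ≤ (haarProbability G (closedBall g r)).toReal)
    (hup : ∀ (g : G) (r : ℝ), 0 < r → (haarProbability G (closedBall g r)).toReal ≤ A * r ^ κ)
    (hEG : ∃ C : ℝ, ∀ (L : ℕ) [NeZero L], 2 ≤ L → ∀ β : ℝ, 1 ≤ β →
      (κ : ℝ) * (((d : ℝ) - 1) * (L : ℝ) ^ d * (1 / 2 - 1 / L) - 1 / 2) * Real.log β - C * (L : ℝ) ^ d ≤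
          (klDiv (wilsonMeasure (d := d) (L := L) ρ β) (Measure.pi fun _ : Edge d L => haarProbability G)).toReal ∧
        (klDiv (wilsonMeasure (d := d) (L := L) ρ β) (Measure.pi fun _ : Edge d L => haarProbability G)).toReal ≤
          (κ : ℝ) * ((((d : ℝ) - 1) * (L : ℝ) ^ d + 1) / 2) * Real.log β + C * (L : ℝ) ^ d) :
    CoolingContractionBetween d N G ρ κ := by
  have haA : a ≤ A := by
    have h1 := hlo 1 1 one_pos le_rfl
    have h2 := hup 1 1 one_pos
    rw [one_pow, mul_one] at h1 h2
    exact h1.trans h2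
  have hA : 0 < A := ha.trans_le haA
  obtain ⟨g₁, hg₁⟩ := exists_ne_one_of_ballVolumes hκ hA hup
  obtain ⟨C, hC⟩ := hEG
  refine ⟨2 * C + d * Real.log (A / a), fun L _ hL β₀ β hβ₀ hβ₀β T K' hT' hmap => ?_⟩
  have hβ0 : 0 ≤ β := by linarith
  have hβ₀0 : 0 ≤ β₀ := by linarith
  have hβ1 : 1 ≤ β := hβ₀.trans hβ₀β
  -- `K' > 0`: two distinct configurations
  have hK'0 : 0 < (K' : ℝ) := by
    set e₀ : Edge d L := (fun _ => 0, ⟨0, hd⟩) with he₀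
    have hne : (fun _ : Edge d L => g₁) ≠ (1 : GaugeConfig d L G) := fun h => hg₁ (by
      have := congr_fun h e₀
      simpa using this)
    have h1 := hT'.le_mul_dist (fun _ : Edge d L => g₁) 1
    have hpos : 0 < dist (fun _ : Edge d L => g₁) (1 : GaugeConfig d L G) := dist_pos.2 hne
    rcases K'.coe_nonneg.eq_or_lt with h | h
    · rw [← h, zero_mul] at h1; linarith
    · exact h
  have hmain := klDiv_sub_klDiv_le_of_antilipschitz ρ hρ htr ha hA hlo hup hβ₀0 hβ0 hK'0 hT' hmap
  have hlo' := (hC L hL β hβ1).1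
  have hup' := (hC L hL β₀ hβ₀).2
  have hE : (Fintype.card (Edge d L) : ℝ) = d * (L : ℝ) ^ d := by
    have hEn : Fintype.card (Edge d L) = L ^ d * d := by simp [Fintype.card_prod, ZMod.card, Fintype.card_fin]
    rw [hEn]; push_cast; ring
  rw [hE] at hmain
  linarith [hmain, hlo', hup']

/-- **(C2a-C°) PROVED from ball volumes + entropy growth** (OURS): as (C2a-C′) with `β₀ = 0`, where `μ_{Λ,0}` is the
product Haar prior and `D(π ‖ π) = 0`; only the entropy LOWER bound is used: `C = C_EG + d·log(A/a)`. [folklore] -/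
theorem exactTransportContractionSharp_of_ballVolumes (d : ℕ) (hd : 1 ≤ d)
    (hρ : Continuous (ρ : G → Matrix (Fin N) (Fin N) ℂ)) (htr : ∀ g, (ρ g).trace.re ≤ N)
    {κ : ℕ} (hκ : 0 < κ) {a A : ℝ} (ha : 0 < a)
    (hlo : ∀ (g : G) (r : ℝ), 0 < r → r ≤ 1 → a * r ^ κ ≤ (haarProbability G (closedBall g r)).toReal)
    (hup : ∀ (g : G) (r : ℝ), 0 < r → (haarProbability G (closedBall g r)).toReal ≤ A * r ^ κ)
    (hEG : ∃ C : ℝ, ∀ (L : ℕ) [NeZero L], 2 ≤ L → ∀ β : ℝ, 1 ≤ β →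
      (κ : ℝ) * (((d : ℝ) - 1) * (L : ℝ) ^ d * (1 / 2 - 1 / L) - 1 / 2) * Real.log β - C * (L : ℝ) ^ d ≤
          (klDiv (wilsonMeasure (d := d) (L := L) ρ β) (Measure.pi fun _ : Edge d L => haarProbability G)).toReal) :
    ExactTransportContractionSharp d N G ρ κ := by
  have haA : a ≤ A := by
    have h1 := hlo 1 1 one_pos le_rfl
    have h2 := hup 1 1 one_pos
    rw [one_pow, mul_one] at h1 h2
    exact h1.trans h2
  have hA : 0 < A := ha.trans_le haA
  obtain ⟨g₁, hg₁⟩ := exists_ne_one_of_ballVolumes hκ hA hup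
  obtain ⟨C, hC⟩ := hEG
  refine ⟨C + d * Real.log (A / a), fun L _ hL β hβ T K' hT' hmap => ?_⟩
  have hβ0 : 0 ≤ β := by linarith
  -- `K' > 0`: two distinct configurations
  have hK'0 : 0 < (K' : ℝ) := by
    set e₀ : Edge d L := (fun _ => 0, ⟨0, hd⟩) with he₀
    have hne : (fun _ : Edge d L => g₁) ≠ (1 : GaugeConfig d L G) := fun h => hg₁ (by
      have := congr_fun h e₀
      simpa using this)
    have h1 := hT'.le_mul_dist (fun _ : Edge d L => g₁) 1
    have hpos : 0 < dist (fun _ : Edge d L => g₁) (1 : GaugeConfig d L G) := dist_pos.2 hne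
    rcases K'.coe_nonneg.eq_or_lt with h | h
    · rw [← h, zero_mul] at h1; linarith
    · exact h
  -- `μ_{Λ,0}` is the product Haar prior (the Wilson weight at `β = 0` is `1`, `Z_Λ(0) = 1`)
  have h00 : wilsonMeasure (d := d) (L := L) ρ 0 = Measure.pi fun _ : Edge d L => haarProbability G := by
    have hW : wilsonWeight (d := d) (L := L) ρ 0 = Measure.pi fun _ : Edge d L => haarProbability G := by
      unfold wilsonWeight
      rw [show (fun U : GaugeConfig d L G => ENNReal.ofReal (Real.exp (-0 * wilsonAction ρ U))) = 1 from
        funext fun U => by simp, withDensity_one]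
    unfold wilsonMeasure partitionFunction
    rw [hW, measure_univ, inv_one, one_smul]
  have hmap' : (wilsonMeasure (d := d) (L := L) ρ 0).map T = wilsonMeasure (d := d) (L := L) ρ β := by
    rw [h00]; exact hmap
  have hmain := klDiv_sub_klDiv_le_of_antilipschitz ρ hρ htr ha hA hlo hup le_rfl hβ0 hK'0 hT' hmap'
  have h0 : (klDiv (wilsonMeasure (d := d) (L := L) ρ 0) (Measure.pi fun _ : Edge d L => haarProbability G)).toReal
      = 0 := by
    rw [h00, klDiv_self, ENNReal.toReal_zero]
  have hlo' := hC L hL β hβ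
  have hE : (Fintype.card (Edge d L) : ℝ) = d * (L : ℝ) ^ d := by
    have hEn : Fintype.card (Edge d L) = L ^ d * d := by simp [Fintype.card_prod, ZMod.card, Fintype.card_fin]
    rw [hEn]; push_cast; ring
  rw [hE, h0] at hmain
  linarith [hmain, hlo']

omit [SecondCountableTopology G] in
/-- **(C2a-C°) ⟹ the tree's `ExactTransportContraction` with the volumetric exponent** (OURS): for `d ≥ 2`, `κ > 0`,
`L ≥ 4` one has `(d-1)L^d(1/2-1/L) - 1/2 ≥ ((d-1)/4 - 1/32)·L^d`, so the sharp law gives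
`log coLip(T) ≥ ((d-1)/4 - 1/32)/d · log β - C/(κd)` for `β ≥ 1`, `L ≥ 4` (`23/128` at `d = 4`; the tree's instances
have `1/(16d) = 1/64`). [folklore] -/
theorem exactTransportContraction_of_sharp {d : ℕ} (hd : 2 ≤ d) {κ : ℝ} (hκ : 0 < κ)
    (h : ExactTransportContractionSharp d N G ρ κ) : ExactTransportContraction d N G ρ := by
  obtain ⟨C, hC⟩ := h
  have hdr : (2 : ℝ) ≤ d := by exact_mod_cast hd
  have hd0 : (0 : ℝ) < d := by linarith
  refine ⟨(((d : ℝ) - 1) / 4 - 1 / 32) / d, by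
      have : (0 : ℝ) < ((d : ℝ) - 1) / 4 - 1 / 32 := by linarith
      positivity,
    C / (κ * d), 1, 4, fun L _ hL β hβ T K' hT' hmap => ?_⟩
  have hL2 : 2 ≤ L := le_trans (by norm_num) hL
  have h1 := hC L hL2 β hβ T K' hT' hmap
  have hL4 : (4 : ℝ) ≤ L := by exact_mod_cast hL
  have hL0 : (0 : ℝ) < L := by linarith
  have hLd : (16 : ℝ) ≤ (L : ℝ) ^ d := by
    calc (16 : ℝ) = 4 ^ 2 := by norm_num
      _ ≤ (L : ℝ) ^ 2 := pow_le_pow_left₀ (by norm_num) hL4 2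
      _ ≤ (L : ℝ) ^ d := pow_le_pow_right₀ (by linarith) hd
  have hLd0 : (0 : ℝ) < (L : ℝ) ^ d := by positivity
  have hlog : 0 ≤ Real.log β := Real.log_nonneg hβ
  -- `(d-1)L^d(1/2-1/L) - 1/2 ≥ ((d-1)/4 - 1/32)·L^d`
  have hcoef : (((d : ℝ) - 1) / 4 - 1 / 32) * (L : ℝ) ^ d ≤
      ((d : ℝ) - 1) * (L : ℝ) ^ d * (1 / 2 - 1 / L) - 1 / 2 := by
    have hinv : 1 / (L : ℝ) ≤ 1 / 4 := by
      rw [div_le_div_iff₀ hL0 (by norm_num)]; linarith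
    have hd1 : (0 : ℝ) ≤ (d : ℝ) - 1 := by linarith
    nlinarith [mul_le_mul_of_nonneg_left hinv (mul_nonneg hd1 hLd0.le)]
  have h2 : κ * ((((d : ℝ) - 1) / 4 - 1 / 32) * (L : ℝ) ^ d) * Real.log β ≤
      κ * (((d : ℝ) - 1) * (L : ℝ) ^ d * (1 / 2 - 1 / L) - 1 / 2) * Real.log β :=
    mul_le_mul_of_nonneg_right (mul_le_mul_of_nonneg_left hcoef hκ.le) hlog
  have hpos : 0 < κ * ((d : ℝ) * (L : ℝ) ^ d) := by positivity
  have key : κ * ((d : ℝ) * (L : ℝ) ^ d) * ((((d : ℝ) - 1) / 4 - 1 / 32) / d * Real.log β - C / (κ * d)) ≤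
      κ * ((d : ℝ) * (L : ℝ) ^ d) * Real.log (K' : ℝ) := by
    have : κ * ((d : ℝ) * (L : ℝ) ^ d) * ((((d : ℝ) - 1) / 4 - 1 / 32) / d * Real.log β - C / (κ * d)) =
        κ * ((((d : ℝ) - 1) / 4 - 1 / 32) * (L : ℝ) ^ d) * Real.log β - C * (L : ℝ) ^ d := by
      field_simp
    rw [this]
    linarith [h1, h2]
  exact le_of_mul_le_mul_left key hpos

end Laws

end Summit.Ventures.LatticeQCDFlow.Theory2.Lattice
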